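import Summits.Ventures.PercRepro.LemmaBPlusK5Def

/-!
# Faces of `K₅`: kernel slices 40 … 43 (part K)

Each theorem is one `decide +kernel` at default heartbeats (≈ 55 s: the 1024-row table of the marking
plus ≤ 22 000 face points in sub-mask loops); generated by `tools/gen_k5.py`.
-/

namespace PercRepro

namespace Examples

open MultiGraph

/-- Slice 40: joins `u ∈ [995, 1003)` of the faces of `K₅` (18954 face points). -/
theorem k5_slice_40 : k5.FacesSRange ![0, 1, 2, 3] 995 1003 := by decide +kernel

/-- Slice 41: joins `u ∈ [1003, 1007)` of the faces of `K₅` (21870 face points). -/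
theorem k5_slice_41 : k5.FacesSRange ![0, 1, 2, 3] 1003 1007 := by decide +kernel

/-- Slice 42: joins `u ∈ [1007, 1009)` of the faces of `K₅` (20412 face points). -/
theorem k5_slice_42 : k5.FacesSRange ![0, 1, 2, 3] 1007 1009 := by decide +kernel

/-- Slice 43: joins `u ∈ [1009, 1014)` of the faces of `K₅` (19683 face points). -/
theorem k5_slice_43 : k5.FacesSRange ![0, 1, 2, 3] 1009 1014 := by decide +kernel

end Examples

end PercRepro
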